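import Batteries.Tactic.OpenPrivate
import Mathlib.Algebra.Polynomial.Roots
import Literature.NumberTheory.Automorphic.UnitaryGroupDoubledSiegelBruhat
import Literature.NumberTheory.GelbartRogawski1991.DoubledUnitaryAdaptedBlocks
import Literature.GroupTheory.GroupChunkExtension
import HarnessLib

/-!
# The big cell of the doubled unitary group `U(𝕍 ⊕ −𝕍)` relative to `P_Δ` is left-generic

Topic `NumberTheory/Automorphic`; namespace `Literature.NumberTheory.Automorphic.DoubledUnitary` (sequel of
`UnitaryGroupDoubledSiegelGeneration` ∕ `UnitaryGroupDoubledSiegelBruhat`).  KERNEL only: proved lemmas (and two auxiliary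
`MonoidHom`s with bodies); no named fact, no `sorry`.  The generic algebra (root avoidance along lines, `Fix(σ)` infinite,
skew matrices) is kept `private`; the public statements are the cited ones about the big cell.

Setting: `K` an INFINITE field with `2 ≠ 0`, a ring involution `σ` (`σ ∘ σ = id`) and `θ ≠ 0` with `σ θ = −θ` (e.g. the
quadratic extension `E_w / F_v` at a non-split place, or `ℂ / ℝ`); the doubled hermitian space in its anti-diagonal model
`J' = antidiag(τ, τ)` (`τ` symmetric, `σ`-fixed, invertible), with Siegel parabolic `P` = block-upper matrices, or in the
diagonal model `S ⊕ (−S)` with `P_Δ = {C = 0}` in the `Δ`-adapted blocks `[[A, B], [C, D]]` of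
`GelbartRogawski1991/DoubledUnitaryAdaptedBlocks`.

MAIN RESULT: **the big cell `Ω = P w P = {g ∣ g₂₁ invertible}` (anti-diagonal model; `{g ∣ C(g) invertible}` in the
diagonal model) is LEFT-GENERIC in `H(K) = U(σ, J)(K)`** in the sense of `Literature.GroupTheory.IsLeftGeneric` (the
hypothesis of Weil's group-chunk Lemme 6, [Weil1964, n° 42]): every finite `T ⊆ H(K)` has a left translate `x T ⊆ Ω`
(`isLeftGeneric_isUnit_block₂₁`, `isLeftGeneric_isUnit_blkC_diag`, `isLeftGeneric_isUnit_blkC_reindex`; also the opposite cell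
`N⁻P = {g ∣ g₁₁ invertible}`, `isLeftGeneric_isUnit_block₁₁`).  Over a local field this is the statement "`Ω` is the
complement of a proper Zariski-closed subset, hence `U⁻¹ ∩ Ua ∩ Ub ∩ Uc ≠ ∅`" which [Weil1964, n° 42] invokes for
`U = Ω(X)` and [Kudla1994, §3] ∕ [HarrisKudlaSweet1996, §1] use for `P w P ⊆ U(n,n)`; here it is proved by elementary algebra:

* PER ELEMENT (`UnitaryGroupDoubledSiegelGeneration`, `exists_upperUnipotent_isUnit_block₁₁`): for every `t ∈ H` there is a
  skew `y` (`τ y + σ(y)ᵀ τ = 0`, so `n⁺(y) ∈ H`) with `(n⁺(y) t)₁₁ = t₁₁ + y t₂₁` invertible;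
* FINITE FAMILIES by ROOT AVOIDANCE (§1–§3): along the `σ`-fixed line `y(λ) = y₁ + λ (y₂ − y₁)` each
  `det(t₁₁ + y(λ) t₂₁)` is a polynomial in `λ`, non-zero as soon as it is non-zero at one `λ`; finitely many non-zero
  polynomials have a common non-root in the infinite set `Fix(σ)` (`K = Fix(σ) ⊕ θ · Fix(σ)` as `2 ≠ 0`);
* `x := w · n⁺(y)` then has `(x t)₂₁ = t₁₁ + y t₂₁` invertible for all `t ∈ T`; the diagonal and re-enumerated models
  follow by transport of `IsLeftGeneric` along the Cayley change of basis and `reindex` (§0, §5, §6).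

Written as brick L4c (the finite-family half of stub J1 `stub_J1_leftGeneric` of GR-1's local skeleton: Kudla's splitting
on the big cell extends to `H(F_v)` by `GroupChunkExtension`) of the kernel construction of [GelbartRogawski1991, Prop. 3.1.1]
(stage-1 cell `pub-hodgecm`, seats GR-1 ∕ GR-2; this file: seat carch-1, 2026-08-21).

## References

* A. Weil, *Sur certains groupes d'opérateurs unitaires*, Acta Math. 111 (1964) 143–211, n° 42 (Lemme 6 and the remark
  following it, pp. 195–196) [Weil1964].
* S. S. Kudla, Israel J. Math. 87 (1994) 361–401, §3 [Kudla1994].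
* M. Harris, S. S. Kudla, W. J. Sweet, J. Amer. Math. Soc. 9 (1996) 941–1004, §1 (1.11)–(1.14) [HarrisKudlaSweet1996].
* A. Borel, *Linear Algebraic Groups*, 2nd ed., GTM 126 (1991), §14.21, §21.15 [Borel1991].
-/

set_option autoImplicit false

noncomputable section

open scoped Matrix MatrixGroups
open Matrix Polynomial

/-! ## §0 Transport of left-genericity: left translates, surjective homomorphisms onto subgroups -/

namespace Literature.GroupTheory.IsLeftGeneric

variable {G : Type*} [Group G] {Ω : Set G}

/-- a left translate `g Ω` of a left-generic set is left-generic (`x ↦ g x`).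
[cite: Weil1964, n° 42, Lemme 6 (hypothesis), p. 195] -/
theorem image_mul_left (hΩ : IsLeftGeneric Ω) (g : G) : IsLeftGeneric ((g * ·) '' Ω) := fun T => by
  obtain ⟨x, hx⟩ := hΩ T
  exact ⟨g * x, fun t ht => ⟨x * t, hx t ht, (mul_assoc g x t).symm⟩⟩

/-- left-genericity descends along a surjective homomorphism to any set containing the image condition:
if `Ω ⊆ G` is left-generic, `p : E →* G` is surjective and `p⁻¹ Ω ⊆ Ω'`, then `Ω'` is left-generic.
[cite: Weil1964, n° 42–43, Lemme 6, pp. 195–196] -/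
theorem of_comap_subset {E : Type*} [Group E] (hΩ : IsLeftGeneric Ω) (p : E →* G) (hp : Function.Surjective p)
    {Ω' : Set E} (h : (p : E → G) ⁻¹' Ω ⊆ Ω') : IsLeftGeneric Ω' :=
  (hΩ.comap p hp).mono h

end Literature.GroupTheory.IsLeftGeneric

namespace Literature.NumberTheory.Automorphic

namespace DoubledUnitary

open Literature.GroupTheory (IsLeftGeneric)

/-! ## §1 Root avoidance: finitely many non-zero polynomials have a common non-root in an infinite set -/

section RootAvoidance

variable {K : Type*} [Field K]

/-- **finitely many non-zero polynomials over a field have a common non-root in any infinite subset** (each has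
finitely many roots). [folklore] -/
private theorem exists_mem_forall_eval_ne_zero {S : Set K} (hS : S.Infinite) {α : Type*} (s : Finset α) (p : α → K[X])
    (hp : ∀ a ∈ s, p a ≠ 0) : ∃ c ∈ S, ∀ a ∈ s, (p a).eval c ≠ 0 := by
  classical
  obtain ⟨c, hcS, hc⟩ := hS.exists_notMem_finset (s.biUnion fun a => (p a).roots.toFinset)
  refine ⟨c, hcS, fun a ha h => hc ?_⟩
  exact Finset.mem_biUnion.2 ⟨a, ha, Multiset.mem_toFinset.2 ((Polynomial.mem_roots (hp a ha)).2 h)⟩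

/-- **root avoidance along lines.**  Let `N ⊆ V` be stable under the affine combinations `v + c (w − v)` with `c` in an
infinite set `S` of scalars, and let `f_a : V → K` (`a ∈ s`, finite) be functions which are POLYNOMIAL along every such
line.  If each `f_a` is non-zero somewhere on `N`, then the `f_a` have a COMMON non-zero on `N` (induction on `s`: join a
common non-zero `v` of the previous ones to a non-zero `w` of the new one by the line `v + c (w − v)`; on it every `f_a` is a
non-zero polynomial in `c` — non-zero at `c = 0`, resp. `c = 1`). [folklore] -/
private theorem exists_mem_forall_ne_zero_of_lines {V : Type*} [AddCommGroup V] [Module K V] {S : Set K} (hS : S.Infinite)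
    {N : Set V} (h0 : N.Nonempty) (hN : ∀ c ∈ S, ∀ v ∈ N, ∀ w ∈ N, v + c • (w - v) ∈ N)
    {α : Type*} (s : Finset α) (f : α → V → K) (hf : ∀ a v w, ∃ p : K[X], ∀ c : K, f a (v + c • (w - v)) = p.eval c)
    (h : ∀ a ∈ s, ∃ v ∈ N, f a v ≠ 0) : ∃ v ∈ N, ∀ a ∈ s, f a v ≠ 0 := by
  classical
  induction s using Finset.induction_on with
  | empty =>
    obtain ⟨v, hv⟩ := h0
    exact ⟨v, hv, fun a ha => absurd ha (Finset.notMem_empty a)⟩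
  | insert a s ha ih =>
    obtain ⟨v, hvN, hv⟩ := ih fun b hb => h b (Finset.mem_insert_of_mem hb)
    obtain ⟨w, hwN, hw⟩ := h a (Finset.mem_insert_self a s)
    choose p hp using fun b => hf b v w
    have hp0 : ∀ b ∈ insert a s, p b ≠ 0 := by
      intro b hb hzero
      rcases Finset.mem_insert.1 hb with rfl | hb'
      · have h1 := hp b 1
        rw [hzero, eval_zero, one_smul, add_sub_cancel] at h1
        exact hw h1
      · have h1 := hp b 0
        rw [hzero, eval_zero, zero_smul, add_zero] at h1
        exact hv b hb' h1
    obtain ⟨c, hcS, hc⟩ := exists_mem_forall_eval_ne_zero hS (insert a s) p hp0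
    exact ⟨v + c • (w - v), hN c hcS v hvN w hwN, fun b hb => by rw [hp b c]; exact hc b hb⟩

/-- **a determinant is polynomial along lines**: `c ↦ det(A + c B)` is (the evaluation of) a polynomial, namely
`det(A + X B) ∈ K[X]`. [folklore] -/
private theorem exists_polynomial_det_add_smul {n : Type*} [Fintype n] [DecidableEq n] (A B : Matrix n n K) :
    ∃ p : K[X], ∀ c : K, (A + c • B).det = p.eval c := by
  refine ⟨(A.map Polynomial.C + (Polynomial.X : K[X]) • B.map Polynomial.C).det, fun c => ?_⟩
  rw [← Polynomial.coe_evalRingHom, RingHom.map_det, RingHom.mapMatrix_apply]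
  congr 1
  ext i j
  simp only [Matrix.map_apply, Matrix.add_apply, Matrix.smul_apply, smul_eq_mul, Polynomial.coe_evalRingHom,
    Polynomial.eval_add, Polynomial.eval_mul, Polynomial.eval_C, Polynomial.eval_X]

end RootAvoidance

/-! ## §2 The fixed field of the involution is infinite (`2 ≠ 0`: `K = Fix(σ) ⊕ θ · Fix(σ)`) -/

section Fixed

variable {K : Type*} [Field K] (σ : K →+* K)

/-- **`Fix(σ)` is infinite** when `K` is: every `x ∈ K` is `a + θ b` with `a = ½(x + σx)`, `b = (x − σx)∕(2θ)` fixed by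
`σ`, so a finite `Fix(σ)` would make `K` finite. [folklore] -/
private theorem infinite_fixedPoints [Infinite K] (hσ : ∀ x, σ (σ x) = x) (h2 : (2 : K) ≠ 0) {θ : K} (hθ : σ θ = -θ)
    (hθ0 : θ ≠ 0) : {a : K | σ a = a}.Infinite := by
  intro hfin
  have hsurj : ∀ x : K, ∃ q : K × K, q ∈ {a : K | σ a = a} ×ˢ {a : K | σ a = a} ∧ q.1 + θ * q.2 = x := by
    intro x
    refine ⟨((x + σ x) / 2, (x - σ x) / (2 * θ)), ⟨?_, ?_⟩, ?_⟩
    · show σ ((x + σ x) / 2) = (x + σ x) / 2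
      rw [map_div₀, map_add, hσ, map_ofNat, add_comm]
    · show σ ((x - σ x) / (2 * θ)) = (x - σ x) / (2 * θ)
      rw [map_div₀, map_sub, hσ, map_mul, map_ofNat, hθ]
      field_simp
      ring
    · show (x + σ x) / 2 + θ * ((x - σ x) / (2 * θ)) = x
      field_simp
      ring
  have huniv : (Set.univ : Set K).Finite := by
    refine ((hfin.prod hfin).image fun q : K × K => q.1 + θ * q.2).subset ?_
    intro x _
    obtain ⟨q, hq, hx⟩ := hsurj x
    exact ⟨q, hq, hx⟩
  exact Set.infinite_univ huniv

end Fixed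

/-! ## §3 The skew matrices `τ y + σ(y)ᵀ τ = 0` (Lie algebra of `N⁺`): an additive group stable under `Fix(σ)` -/

section Skew

variable {K : Type*} [Field K] {ι : Type*} [Fintype ι] [DecidableEq ι] (σ : K →+* K) (τ : Matrix ι ι K)

/-- the `τ`-skew matrices `{y ∣ τ y + σ(y)ᵀ τ = 0}` — exactly the `y` with `n⁺(y) ∈ U(σ, antidiag(τ, τ))`.
[cite: HarrisKudlaSweet1996, §1 (1.11)] -/
def skewSet : Set (Matrix ι ι K) := {y | τ * y + (y.map σ)ᵀ * τ = 0}

omit [DecidableEq ι] in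
/-- membership. [cite: HarrisKudlaSweet1996, §1 (1.11)] -/
theorem mem_skewSet_iff (y : Matrix ι ι K) : y ∈ skewSet σ τ ↔ τ * y + (y.map σ)ᵀ * τ = 0 := Iff.rfl

omit [DecidableEq ι] in
/-- `0` is skew. [folklore] -/
private theorem zero_mem_skewSet : (0 : Matrix ι ι K) ∈ skewSet σ τ := by
  rw [mem_skewSet_iff, Matrix.map_zero σ (map_zero σ), Matrix.transpose_zero, Matrix.mul_zero, Matrix.zero_mul,
    add_zero]

omit [DecidableEq ι] in
/-- the skew matrices are stable under the affine combinations `v + c (w − v)` with `σ c = c`. [folklore] -/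
private theorem lineComb_mem_skewSet {c : K} (hc : σ c = c) {v w : Matrix ι ι K} (hv : v ∈ skewSet σ τ)
    (hw : w ∈ skewSet σ τ) : v + c • (w - v) ∈ skewSet σ τ := by
  rw [mem_skewSet_iff] at hv hw ⊢
  have hmap : (v + c • (w - v)).map σ = v.map σ + c • (w.map σ - v.map σ) := by
    rw [Matrix.map_add _ (map_add σ), Matrix.map_smul' (σ : K → K) c (w - v) (map_mul σ), hc,
      Matrix.map_sub _ (map_sub σ)]
  rw [hmap, Matrix.transpose_add, Matrix.transpose_smul, Matrix.transpose_sub, Matrix.mul_add, Matrix.mul_smul,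
    Matrix.mul_sub, Matrix.add_mul, Matrix.smul_mul, Matrix.sub_mul]
  have key : τ * v + c • (τ * w - τ * v) + ((v.map σ)ᵀ * τ + c • ((w.map σ)ᵀ * τ - (v.map σ)ᵀ * τ)) =
      (τ * v + (v.map σ)ᵀ * τ) + c • ((τ * w + (w.map σ)ᵀ * τ) - (τ * v + (v.map σ)ᵀ * τ)) := by
    rw [smul_sub, smul_sub, smul_sub, smul_add, smul_add]
    abel
  rw [key, hv, hw, sub_zero, smul_zero, add_zero]

end Skew

/-! ## §4 The anti-diagonal model: `{g ∣ g₁₁ invertible}` and the big cell `{g ∣ g₂₁ invertible}` are left-generic -/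

section Antidiag

open private exists_upperUnipotent_isUnit_block₁₁ upperUnipotent_mem weylSwap_mem from
  Literature.NumberTheory.Automorphic.UnitaryGroupDoubledSiegelGeneration

variable {K : Type*} [Field K] {ι : Type*} [Fintype ι] [DecidableEq ι] (σ : K →+* K) {τ : Matrix ι ι K}

/-- the `(1,1)`-block of `n⁺(y) g` is `g₁₁ + y g₂₁` (`n⁺(y) = n(b)` of the Bruhat cells `P w_j P`).
[cite: HarrisKudlaSweet1996, §1 (1.12)] -/
theorem toBlocks₁₁_upperUnipotent_mul (y : Matrix ι ι K) (g : GL (ι ⊕ ι) K) :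
    ((upperUnipotent y * g : GL (ι ⊕ ι) K) : Matrix (ι ⊕ ι) (ι ⊕ ι) K).toBlocks₁₁ =
      (g : Matrix (ι ⊕ ι) (ι ⊕ ι) K).toBlocks₁₁ + y * (g : Matrix (ι ⊕ ι) (ι ⊕ ι) K).toBlocks₂₁ := by
  rw [Units.val_mul, show ((upperUnipotent y : GL (ι ⊕ ι) K) : Matrix (ι ⊕ ι) (ι ⊕ ι) K) =
      Matrix.fromBlocks 1 y 0 1 from rfl]
  conv_lhs => rw [← Matrix.fromBlocks_toBlocks (g : Matrix (ι ⊕ ι) (ι ⊕ ι) K), Matrix.fromBlocks_multiply]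
  rw [Matrix.toBlocks_fromBlocks₁₁, Matrix.one_mul]

/-- the `(2,1)`-block of `w g` is `g₁₁` (`w = w_n` swaps the two block rows). [cite: HarrisKudlaSweet1996, §1 (1.12)] -/
theorem toBlocks₂₁_weylSwap_mul (g : GL (ι ⊕ ι) K) :
    ((weylSwap * g : GL (ι ⊕ ι) K) : Matrix (ι ⊕ ι) (ι ⊕ ι) K).toBlocks₂₁ = (g : Matrix (ι ⊕ ι) (ι ⊕ ι) K).toBlocks₁₁ := by
  rw [Units.val_mul, show ((weylSwap : GL (ι ⊕ ι) K) : Matrix (ι ⊕ ι) (ι ⊕ ι) K) = Matrix.fromBlocks 0 1 1 0 from rfl]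
  conv_lhs => rw [← Matrix.fromBlocks_toBlocks (g : Matrix (ι ⊕ ι) (ι ⊕ ι) K), Matrix.fromBlocks_multiply]
  rw [Matrix.toBlocks_fromBlocks₂₁, Matrix.one_mul, Matrix.zero_mul, add_zero]

/-- **the opposite cell `N⁻ P = {g ∣ g₁₁ invertible}` is left-generic in `U(σ, antidiag(τ, τ))`** (`K` infinite,
`2 ≠ 0`, `σ θ = −θ ≠ 0`, `τ` symmetric `σ`-fixed invertible): for every finite `T ⊆ U` there is a skew `y` with
`det(t₁₁ + y t₂₁) ≠ 0` for all `t ∈ T`, i.e. `n⁺(y) T ⊆ N⁻P` — per element by `exists_upperUnipotent_isUnit_block₁₁`, for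
the family by root avoidance along `Fix(σ)`-lines of skew matrices. [cite: Weil1964, n° 42 (after Lemme 6), p. 196] -/
theorem isLeftGeneric_isUnit_block₁₁ [Infinite K] (hσ : ∀ x, σ (σ x) = x) (h2 : (2 : K) ≠ 0) {θ : K}
    (hθ : σ θ = -θ) (hθ0 : θ ≠ 0) (hτ : τ.map σ = τ) (hτs : τᵀ = τ) (hτu : IsUnit τ.det) :
    IsLeftGeneric {g : ↥(unitaryGroupOfForm σ (antidiagForm τ)) |
      IsUnit (((g : GL (ι ⊕ ι) K) : Matrix (ι ⊕ ι) (ι ⊕ ι) K).toBlocks₁₁)} := by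
  classical
  intro T
  -- the functions `f_t(y) = det(t₁₁ + y t₂₁)` on the skew matrices
  obtain ⟨y, hyN, hy⟩ := exists_mem_forall_ne_zero_of_lines (infinite_fixedPoints σ hσ h2 hθ hθ0)
    (N := skewSet σ τ) ⟨0, zero_mem_skewSet σ τ⟩ (fun c hc v hv w hw => lineComb_mem_skewSet σ τ hc hv hw) T
    (fun (t : ↥(unitaryGroupOfForm σ (antidiagForm τ))) (y : Matrix ι ι K) =>
      (((t : GL (ι ⊕ ι) K) : Matrix (ι ⊕ ι) (ι ⊕ ι) K).toBlocks₁₁ +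
        y * ((t : GL (ι ⊕ ι) K) : Matrix (ι ⊕ ι) (ι ⊕ ι) K).toBlocks₂₁).det)
    (fun t v w => by
      obtain ⟨p, hp⟩ := exists_polynomial_det_add_smul
        (((t : GL (ι ⊕ ι) K) : Matrix (ι ⊕ ι) (ι ⊕ ι) K).toBlocks₁₁ +
          v * ((t : GL (ι ⊕ ι) K) : Matrix (ι ⊕ ι) (ι ⊕ ι) K).toBlocks₂₁)
        ((w - v) * ((t : GL (ι ⊕ ι) K) : Matrix (ι ⊕ ι) (ι ⊕ ι) K).toBlocks₂₁)
      refine ⟨p, fun c => ?_⟩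
      rw [← hp c, Matrix.add_mul, Matrix.smul_mul, add_assoc])
    (fun t _ => by
      obtain ⟨y, hy, hunit⟩ := exists_upperUnipotent_isUnit_block₁₁ σ hσ hθ hθ0 hτ hτs hτu t.2
      refine ⟨y, hy, ?_⟩
      rw [← toBlocks₁₁_upperUnipotent_mul]
      exact ((Matrix.isUnit_iff_isUnit_det _).1 hunit).ne_zero)
  refine ⟨⟨upperUnipotent y, upperUnipotent_mem σ hyN⟩, fun t ht => ?_⟩
  show IsUnit (((upperUnipotent y * (t : GL (ι ⊕ ι) K) : GL (ι ⊕ ι) K) : Matrix (ι ⊕ ι) (ι ⊕ ι) K).toBlocks₁₁)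
  rw [toBlocks₁₁_upperUnipotent_mul, Matrix.isUnit_iff_isUnit_det]
  exact isUnit_iff_ne_zero.2 (hy t ht)

/-- **the big cell `P w P = {g ∣ g₂₁ invertible}` of `U(σ, antidiag(τ, τ))` is left-generic** (`w N⁻P ⊆ P w P`:
`(w g)₂₁ = g₁₁`). [cite: Weil1964, n° 42 (after Lemme 6), p. 196] -/
theorem isLeftGeneric_isUnit_block₂₁ [Infinite K] (hσ : ∀ x, σ (σ x) = x) (h2 : (2 : K) ≠ 0) {θ : K}
    (hθ : σ θ = -θ) (hθ0 : θ ≠ 0) (hτ : τ.map σ = τ) (hτs : τᵀ = τ) (hτu : IsUnit τ.det) :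
    IsLeftGeneric {g : ↥(unitaryGroupOfForm σ (antidiagForm τ)) |
      IsUnit (((g : GL (ι ⊕ ι) K) : Matrix (ι ⊕ ι) (ι ⊕ ι) K).toBlocks₂₁)} := by
  set w : ↥(unitaryGroupOfForm σ (antidiagForm τ)) := ⟨weylSwap, weylSwap_mem σ τ⟩
  refine ((isLeftGeneric_isUnit_block₁₁ σ hσ h2 hθ hθ0 hτ hτs hτu).image_mul_left w).mono ?_
  rintro _ ⟨g, hg, rfl⟩
  show IsUnit (((weylSwap * (g : GL (ι ⊕ ι) K) : GL (ι ⊕ ι) K) : Matrix (ι ⊕ ι) (ι ⊕ ι) K).toBlocks₂₁)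
  rw [toBlocks₂₁_weylSwap_mul]
  exact hg

end Antidiag

/-! ## §5 The diagonal model `S ⊕ (−S)`: the big cell `{g ∣ C(g) invertible}` in `Δ`-adapted blocks is left-generic -/

section Diag

variable {K : Type*} [Field K] {ι : Type*} [Fintype ι] [DecidableEq ι] (σ : K →+* K) {S : Matrix ι ι K}

/-- **`C⁻¹ g C = adapt g`**: conjugation by the Cayley change of basis `C = [[1, 1], [1, −1]]` of
`UnitaryGroupDoubledSiegelGeneration` IS the passage to `Δ`-adapted blocks of `DoubledUnitaryAdaptedBlocks`
(`adapt M = R⁻¹ M R`, `R = C`). [cite: HarrisKudlaSweet1996, §1 (1.11)] -/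
theorem coe_cayley_inv_mul_mul_cayley [Invertible (2 : K)] (h2 : (2 : K) ≠ 0) (g : GL (ι ⊕ ι) K) :
    (((cayley K ι h2)⁻¹ * g * cayley K ι h2 : GL (ι ⊕ ι) K) : Matrix (ι ⊕ ι) (ι ⊕ ι) K) =
      GelbartRogawski1991.AdaptedBlocks.adapt (g : Matrix (ι ⊕ ι) (ι ⊕ ι) K) := by
  rw [Units.val_mul, Units.val_mul, GelbartRogawski1991.AdaptedBlocks.adapt,
    GelbartRogawski1991.AdaptedBlocks.cayRinv, GelbartRogawski1991.AdaptedBlocks.cayR, coe_cayley, invOf_eq_inv]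
  congr 2
  show Matrix.fromBlocks ((2 : K)⁻¹ • 1) ((2 : K)⁻¹ • 1) ((2 : K)⁻¹ • 1) (-((2 : K)⁻¹ • 1)) = _
  rw [Matrix.fromBlocks_smul, smul_neg]

/-- hence **the lower-left adapted block of `g` is the `(2,1)`-block of `C⁻¹ g C`**: `C(g) = (C⁻¹ g C)₂₁`.
[cite: Kudla1994, §3] -/
theorem blkC_eq_toBlocks₂₁_conj [Invertible (2 : K)] (h2 : (2 : K) ≠ 0) (g : GL (ι ⊕ ι) K) :
    GelbartRogawski1991.AdaptedBlocks.blkC (g : Matrix (ι ⊕ ι) (ι ⊕ ι) K) =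
      (((cayley K ι h2)⁻¹ * g * cayley K ι h2 : GL (ι ⊕ ι) K) : Matrix (ι ⊕ ι) (ι ⊕ ι) K).toBlocks₂₁ := by
  rw [coe_cayley_inv_mul_mul_cayley, GelbartRogawski1991.AdaptedBlocks.adapt_eq, Matrix.toBlocks_fromBlocks₂₁]

/-- the conjugation `g ↦ C⁻¹ g C` as a homomorphism `U(σ, S ⊕ −S) →* U(σ, antidiag(S+S, S+S))` (restriction of the
inner automorphism `MulAut.conj C⁻¹`). [cite: HarrisKudlaSweet1996, §1 (1.11)] -/
def cayleyConjHom (h2 : (2 : K) ≠ 0) (S : Matrix ι ι K) :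
    ↥(unitaryGroupOfForm σ (diagForm S)) →* ↥(unitaryGroupOfForm σ (antidiagForm (S + S))) :=
  ((MulAut.conj (cayley K ι h2)⁻¹).toMonoidHom.comp (unitaryGroupOfForm σ (diagForm S)).subtype).codRestrict _
    fun g => by
      rw [MonoidHom.comp_apply, MulEquiv.coe_toMonoidHom, MulAut.conj_apply, inv_inv, Subgroup.coe_subtype,
        cayley_inv_conj_mem_antidiag_iff]
      exact g.2

/-- `cayleyConjHom g = C⁻¹ g C` on underlying elements. [cite: HarrisKudlaSweet1996, §1 (1.11)] -/
theorem coe_cayleyConjHom (h2 : (2 : K) ≠ 0) (S : Matrix ι ι K) (g : ↥(unitaryGroupOfForm σ (diagForm S))) :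
    ((cayleyConjHom σ h2 S g : ↥(unitaryGroupOfForm σ (antidiagForm (S + S)))) : GL (ι ⊕ ι) K) =
      (cayley K ι h2)⁻¹ * (g : GL (ι ⊕ ι) K) * cayley K ι h2 := by
  show (cayley K ι h2)⁻¹ * (g : GL (ι ⊕ ι) K) * ((cayley K ι h2)⁻¹)⁻¹ = _
  rw [inv_inv]

/-- `cayleyConjHom` is surjective (`q = C⁻¹ (C q C⁻¹) C`). [cite: HarrisKudlaSweet1996, §1 (1.11)] -/
theorem cayleyConjHom_surjective (h2 : (2 : K) ≠ 0) (S : Matrix ι ι K) :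
    Function.Surjective (cayleyConjHom σ h2 S) := by
  intro q
  refine ⟨⟨cayley K ι h2 * (q : GL (ι ⊕ ι) K) * (cayley K ι h2)⁻¹, (cayley_conj_mem_diag_iff σ h2 S _).2 q.2⟩,
    Subtype.ext ?_⟩
  rw [coe_cayleyConjHom]
  group

/-- **the big cell `{g ∣ C(g) invertible}` of `U(σ, S ⊕ −S)` is left-generic** (`K` infinite with `⅟2`, `σ θ = −θ ≠ 0`,
`S` symmetric `σ`-fixed of unit determinant; `C(g) = ½(g₁₁ + g₁₂ − g₂₁ − g₂₂)` the `Δ → Δ⁻` adapted block of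
`DoubledUnitaryAdaptedBlocks`) — transport of `isLeftGeneric_isUnit_block₂₁` along `g ↦ C⁻¹ g C`.
[cite: Kudla1994, §3; Weil1964, n° 42 (after Lemme 6), p. 196] -/
theorem isLeftGeneric_isUnit_blkC_diag [Infinite K] [Invertible (2 : K)] (hσ : ∀ x, σ (σ x) = x) {θ : K}
    (hθ : σ θ = -θ) (hθ0 : θ ≠ 0) (hSσ : S.map σ = S) (hSs : Sᵀ = S) (hSu : IsUnit S.det) :
    IsLeftGeneric {g : ↥(unitaryGroupOfForm σ (diagForm S)) |
      IsUnit (GelbartRogawski1991.AdaptedBlocks.blkC ((g : GL (ι ⊕ ι) K) : Matrix (ι ⊕ ι) (ι ⊕ ι) K))} := by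
  have h2 : (2 : K) ≠ 0 := Invertible.ne_zero 2
  have hτ : (S + S).map σ = S + S := by rw [Matrix.map_add σ (map_add σ), hSσ]
  have hτs : (S + S)ᵀ = S + S := by rw [Matrix.transpose_add, hSs]
  have hτu : IsUnit (S + S).det := by
    rw [← two_smul K S, Matrix.det_smul]
    exact ((isUnit_iff_ne_zero.2 h2).pow _).mul hSu
  refine (isLeftGeneric_isUnit_block₂₁ σ hσ h2 hθ hθ0 hτ hτs hτu).of_comap_subset (cayleyConjHom σ h2 S)
    (cayleyConjHom_surjective σ h2 S) fun g hg => ?_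
  show IsUnit (GelbartRogawski1991.AdaptedBlocks.blkC ((g : GL (ι ⊕ ι) K) : Matrix (ι ⊕ ι) (ι ⊕ ι) K))
  rw [blkC_eq_toBlocks₂₁_conj h2, ← coe_cayleyConjHom σ h2 S g]
  exact hg

end Diag

/-! ## §6 Re-enumerated forms `reindex e e (S ⊕ −S)` (e.g. `e = finSumFinEquiv : Fin n ⊕ Fin n ≃ Fin (n + n)`) -/

section Reindex

variable {K : Type*} [Field K] {ι : Type*} [Fintype ι] [DecidableEq ι] (σ : K →+* K) {S : Matrix ι ι K}
variable {m : Type*} [Fintype m] [DecidableEq m] (e : ι ⊕ ι ≃ m)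

/-- un-reindexing `γ ↦ reindex e⁻¹ e⁻¹ γ` as a homomorphism `U(σ, reindex e e (S ⊕ −S)) →* U(σ, S ⊕ −S)`.
[cite: HarrisKudlaSweet1996, §1 (1.11)] -/
def unreindexHom (S : Matrix ι ι K) :
    ↥(unitaryGroupOfForm σ (Matrix.reindex e e (diagForm S))) →* ↥(unitaryGroupOfForm σ (diagForm S)) :=
  ((Units.mapEquiv (Matrix.reindexRingEquiv K e).toMulEquiv).symm.toMonoidHom.comp
      (unitaryGroupOfForm σ (Matrix.reindex e e (diagForm S))).subtype).codRestrict _ fun γ => by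
    have hsub : (Matrix.reindex e e (diagForm S)).submatrix e e = diagForm (K := K) S := by
      rw [Matrix.reindex_apply, Matrix.submatrix_submatrix, Equiv.symm_comp_self, Matrix.submatrix_id_id]
    have key : (Units.mapEquiv (Matrix.reindexRingEquiv K e).toMulEquiv).symm (γ : GL m K) ∈
        unitaryGroupOfForm σ ((Matrix.reindex e e (diagForm S)).submatrix e e) := by
      rw [reindex_mem_unitaryGroupOfForm_iff σ e, MulEquiv.apply_symm_apply]
      exact γ.2
    rw [hsub] at key
    exact key

/-- `unreindexHom γ` on underlying matrices: `reindex e⁻¹ e⁻¹ γ` (`= γ.submatrix e e`). [cite: HarrisKudlaSweet1996, §1 (1.11)] -/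
theorem coe_unreindexHom (S : Matrix ι ι K) (γ : ↥(unitaryGroupOfForm σ (Matrix.reindex e e (diagForm S)))) :
    (((unreindexHom σ e S γ : ↥(unitaryGroupOfForm σ (diagForm S))) : GL (ι ⊕ ι) K) : Matrix (ι ⊕ ι) (ι ⊕ ι) K) =
      Matrix.reindex e.symm e.symm ((γ : GL m K) : Matrix m m K) :=
  rfl

/-- `unreindexHom` is surjective (it is the restriction of the inverse of `reindex e e`). [cite: HarrisKudlaSweet1996, §1 (1.11)] -/
theorem unreindexHom_surjective (S : Matrix ι ι K) : Function.Surjective (unreindexHom σ e S) := by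
  intro g
  have hsub : (Matrix.reindex e e (diagForm S)).submatrix e e = diagForm (K := K) S := by
    rw [Matrix.reindex_apply, Matrix.submatrix_submatrix, Equiv.symm_comp_self, Matrix.submatrix_id_id]
  have hmem : (Units.mapEquiv (Matrix.reindexRingEquiv K e).toMulEquiv (g : GL (ι ⊕ ι) K) : GL m K) ∈
      unitaryGroupOfForm σ (Matrix.reindex e e (diagForm S)) := by
    rw [← reindex_mem_unitaryGroupOfForm_iff σ e, hsub]; exact g.2
  refine ⟨⟨_, hmem⟩, Subtype.ext ?_⟩
  show (Units.mapEquiv (Matrix.reindexRingEquiv K e).toMulEquiv).symm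
      (Units.mapEquiv (Matrix.reindexRingEquiv K e).toMulEquiv (g : GL (ι ⊕ ι) K)) = _
  rw [MulEquiv.symm_apply_apply]

/-- **the big cell of `U(σ, reindex e e (S ⊕ −S))` is left-generic**: for every finite family `T` of elements there is
`x` in the group with `C(reindex e⁻¹ e⁻¹ (x t))` invertible for all `t ∈ T` — the form consumed at `J^𝔻 = reindex e₂ e₂
(T₀ ⊕ −T₀)` by the local splitting package (stub J1: with `GroupChunkExtension`, Kudla's big-cell function extends to
`H(F_v)`). [cite: Kudla1994, §3; Weil1964, n° 42 (after Lemme 6), p. 196] -/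
theorem isLeftGeneric_isUnit_blkC_reindex [Infinite K] [Invertible (2 : K)] (hσ : ∀ x, σ (σ x) = x) {θ : K}
    (hθ : σ θ = -θ) (hθ0 : θ ≠ 0) (hSσ : S.map σ = S) (hSs : Sᵀ = S) (hSu : IsUnit S.det) :
    IsLeftGeneric {γ : ↥(unitaryGroupOfForm σ (Matrix.reindex e e (diagForm S))) |
      IsUnit (GelbartRogawski1991.AdaptedBlocks.blkC (Matrix.reindex e.symm e.symm ((γ : GL m K) : Matrix m m K)))} := by
  refine (isLeftGeneric_isUnit_blkC_diag σ hσ hθ hθ0 hSσ hSs hSu).of_comap_subset (unreindexHom σ e S)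
    (unreindexHom_surjective σ e S) fun γ hγ => ?_
  show IsUnit (GelbartRogawski1991.AdaptedBlocks.blkC (Matrix.reindex e.symm e.symm ((γ : GL m K) : Matrix m m K)))
  rw [← coe_unreindexHom σ e S γ]
  exact hγ

/-- **consumer form** (typed on the subgroup, for an arbitrary spelling `J` of the form): for
`J = reindex e e (S ⊕ −S)`, the set of `γ : ↥U(σ, J)` whose `Δ → Δ⁻` adapted block `C(reindex e⁻¹ e⁻¹ γ)` is invertible is
left-generic.  (Stub J1 of the GR-1 local package is this at `K = E_w`, `σ = c_w`, `θ = δ`, `S = T₀`, `e = e₂ n`, pulled back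
along `U(J^𝔻)(F_v) ≅ U(σ, J^𝔻)(E_w)` with `IsLeftGeneric.comap`, once `Ω_H = {C invertible}` is read through `ι^𝔻`.)
[cite: Kudla1994, §3; Weil1964, n° 42 (after Lemme 6), p. 196] -/
theorem isLeftGeneric_isUnit_blkC_subtype [Infinite K] [Invertible (2 : K)] (hσ : ∀ x, σ (σ x) = x) {θ : K}
    (hθ : σ θ = -θ) (hθ0 : θ ≠ 0) (hSσ : S.map σ = S) (hSs : Sᵀ = S) (hSu : IsUnit S.det)
    (J : Matrix m m K) (hJ : J = Matrix.reindex e e (Matrix.fromBlocks S 0 0 (-S))) :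
    IsLeftGeneric {γ : ↥(unitaryGroupOfForm σ J) |
      IsUnit (GelbartRogawski1991.AdaptedBlocks.blkC (Matrix.reindex e.symm e.symm ((γ : GL m K) : Matrix m m K)))} := by
  subst hJ
  exact isLeftGeneric_isUnit_blkC_reindex σ e hσ hθ hθ0 hSσ hSs hSu

end Reindex

end DoubledUnitary

end Literature.NumberTheory.Automorphic
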